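import Summits.AtomisticToContinuum.BoseEinsteinCondensation.Theorems.BECThomsonPrincipleGDTransferSeededWitnessDefs
import Summits.AtomisticToContinuum.BoseEinsteinCondensation.Theorems.BECThomsonPrincipleGDTransferSeededProjectedDichotomyPositivity
import Summits.AtomisticToContinuum.BoseEinsteinCondensation.Theorems.BECThomsonPrincipleGDTransferSeededCountLaw
import Summits.AtomisticToContinuum.BoseEinsteinCondensation.Theorems.BECThomsonPrincipleGDTransferSeededSecondMomentCount

/-!
# Route `BECThomsonPrinciple`, crux `GDTransfer` (stmt-AtomisticToContinuum-9482), line `seeded-continuity`: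
# stub `stub_plainPairAlgebra`, part 3 — (A3) zero defect against the LNSS source, (A4) the weighted occupation

Support file of the registered stub `stub_plainPairAlgebra`.  For the plain pair `ζ₊ = plainUp n Ψ = N^{-1/2}B_nΨ`,
`ζ₋ = plainDown n Ψ = N^{-1/2}B_n†Ψ` of a periodic trial state `Ψ` and EVERY mode `n ∈ ℤ³`:
(A3) `‖ζ₊‖² + ‖ζ₋‖² ≤ 2N|σ_n(ζ₊,Ψ) + σ_n(Ψ,ζ₋)|` and (A4) `weightedOcc n Ψ ≤ 2‖ζ₋‖²` (`plainPair_zeroDefect`).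
* `n ≠ 0`: this is the landed `plainPair_positivity` (`…SeededProjectedDichotomyPositivity`, p140245: sector calculus,
  `B_n` lowers and `B_n†` raises `n̂₀` by one, `n̂₀^{-1/2} ≥ N^{-1/2}` off the empty sector) after matching the scalar
  `(√((m+1 : ℕ)))⁻¹ = (√(m+1))⁻¹` (`plainUp_eq`, `plainDown_eq`);
* `n = 0`: `B_0 = B_0† = n̂₀ = Σ_i P_i` (`e_0 = 1`, `P_i^{(0)} = P_i`: the landed `SecondMoment.fourierAvg_modeZero`),
  so `ζ₊ = ζ₋` (`plainUp_zero`), and `n̂₀` commutes with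
  `n̂₀^{-1/2}` (`cellAvg_rootInv_comm`: both are diagonal in the `Q_S`), so `Λ_0†Ψ = Λ_0Ψ = n̂₀^{-1/2}h`, `h = n̂₀Ψ`
  (`lnssUpper_zero`); hence by (L2) `Nσ_0(ζ₊,Ψ) = Nσ_0(Ψ,ζ₋) = N^{-1/2}⟨h, n̂₀^{-1/2}h⟩ ≥ N⁻¹‖h‖²` by the landed
  `Cardinality.integral_conj_mul_rootInv_self` / `rootInv_lower` (`Q_∅ h = 0`).
(A4) is `weightedOcc = ‖ζ₋‖²` by definition.  All [folklore] (arXiv:1211.2778 §2; LSSY2005 App. A).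
-/

noncomputable section

open MeasureTheory Filter
open scoped ENNReal NNReal ComplexConjugate

namespace Summit.AtomisticToContinuum.BoseEinsteinCondensation.Cruxes.GDTransfer.Seeded

namespace PlainZeroDefect

open Literature.MathematicalPhysics.QuantumManyBody.BoseGas
open Summit.AtomisticToContinuum.BoseEinsteinCondensation.Theorems.GaussianDominationCan.Negative
open Summit.AtomisticToContinuum.BoseEinsteinCondensation.Cruxes.GDTransfer.DysonDressedWitness
open ChordVariation (continuous_modeProj dir_const_mul mass_smul)
open Lnss

variable {m : ℕ} {L : ℝ}

/-! ## Matching the scalar `N^{-1/2}` -/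

/-- `ζ₊` with the scalar written as `(√(m+1))⁻¹`. [folklore] -/
theorem plainUp_eq (m : ℕ) (L : ℝ) (n : Fin 3 → ℤ) (g : Config (m + 1) → ℂ) :
    plainUp m L n g = fun X => ((Real.sqrt ((m : ℝ) + 1))⁻¹ : ℂ) *
      ∑ i : Fin (m + 1), cellWave L n (X i) * cellAvg (m + 1) L i g X := by
  funext X
  simp only [plainUp, Nat.cast_succ]

/-- `ζ₋` with the scalar written as `(√(m+1))⁻¹`. [folklore] -/
theorem plainDown_eq (m : ℕ) (L : ℝ) (n : Fin 3 → ℤ) (g : Config (m + 1) → ℂ) :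
    plainDown m L n g = fun X => ((Real.sqrt ((m : ℝ) + 1))⁻¹ : ℂ) * ∑ i : Fin (m + 1), fourierAvg m L n i g X := by
  funext X
  simp only [plainDown, Nat.cast_succ]

/-- **(A3) for `n ≠ 0`** — the landed `plainPair_positivity`. [folklore] -/
theorem mass_add_mass_le_of_ne_zero (hL : 0 < L) {n : Fin 3 → ℤ} (hn : n ≠ 0) (Ψ : PeriodicTrialState (m + 1) L) :
    mass L (plainUp m L n Ψ.ψ) + mass L (plainDown m L n Ψ.ψ) ≤
      2 * ENNReal.ofReal (((m + 1 : ℕ) : ℝ) *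
        ‖srcPair m L n (plainUp m L n Ψ.ψ) Ψ.ψ + srcPair m L n Ψ.ψ (plainDown m L n Ψ.ψ)‖) := by
  rw [plainUp_eq, plainDown_eq]
  exact plainPair_positivity m L hL n hn Ψ

/-! ## The mode `n = 0`: `B_0 = B_0† = n̂₀` commutes with `n̂₀^{-1/2}` -/

/-- For `n = 0` the plain pair coincide: `ζ₊ = ζ₋ = N^{-1/2} n̂₀ g`. [folklore] -/
theorem plainUp_zero (g : Config (m + 1) → ℂ) : plainUp m L 0 g = plainDown m L 0 g := by
  funext X
  simp only [plainUp, plainDown, cellWave_zero, one_mul, SecondMoment.fourierAvg_modeZero]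

/-- **`P_i` commutes with `n̂₀^{-1/2}`** on continuous functions (`P_iQ_S = Q_SP_i = [i ∈ S]Q_S`). [folklore] -/
theorem cellAvg_rootInv_comm (hL : 0 < L) (i : Fin (m + 1)) {g : Config (m + 1) → ℂ} (hg : Continuous g) :
    cellAvg (m + 1) L i (rootInv m L g) = rootInv m L (cellAvg (m + 1) L i g) := by
  unfold rootInv
  rw [cellAvg_finset_sum _ _ (fun S _ => continuous_modeProj S hg)]
  funext X
  refine Finset.sum_congr rfl fun S _ => ?_
  rw [cellAvg_modeProj hL S i hg, modeProj_cellAvg hL S i hg]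

/-- `n̂₀^{-1/2}` through a finite sum of continuous functions. [folklore] -/
theorem rootInv_finset_sum {ι : Type*} (T : Finset ι) {f : ι → Config (m + 1) → ℂ}
    (hf : ∀ t ∈ T, Continuous (f t)) :
    rootInv m L (fun X => ∑ t ∈ T, f t X) = fun X => ∑ t ∈ T, rootInv m L (f t) X := by
  funext X
  unfold rootInv
  simp only [modeProj_finset_sum T hf, Finset.mul_sum]
  rw [Finset.sum_comm]

/-- **`Λ_0† = Λ_0`** on continuous functions: `n̂₀ n̂₀^{-1/2} g = n̂₀^{-1/2} n̂₀ g`. [folklore] -/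
theorem lnssUpper_zero (hL : 0 < L) {g : Config (m + 1) → ℂ} (hg : Continuous g) :
    lnssUpper m L 0 g = lnssLower m L 0 g := by
  unfold lnssUpper lnssLower
  simp only [cellWave_zero, one_mul, cellAvg_rootInv_comm hL _ hg, SecondMoment.fourierAvg_modeZero]
  rw [rootInv_finset_sum _ (fun i _ => continuous_cellAvg i hg)]

/-- **(A3) for `n = 0`**: `‖ζ₊‖² + ‖ζ₋‖² ≤ 2N|σ_0(ζ₊,Ψ) + σ_0(Ψ,ζ₋)|` (`ζ₊ = ζ₋ = N^{-1/2}h`, `h = n̂₀Ψ`, both overlaps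
equal `N^{-1/2}⟨h, n̂₀^{-1/2}h⟩ ≥ N⁻¹‖h‖²`). [folklore] -/
theorem mass_add_mass_le_zero (hL : 0 < L) (Ψ : PeriodicTrialState (m + 1) L) :
    mass L (plainUp m L 0 Ψ.ψ) + mass L (plainDown m L 0 Ψ.ψ) ≤
      2 * ENNReal.ofReal (((m + 1 : ℕ) : ℝ) *
        ‖srcPair m L 0 (plainUp m L 0 Ψ.ψ) Ψ.ψ + srcPair m L 0 Ψ.ψ (plainDown m L 0 Ψ.ψ)‖) := by
  have hψ : Continuous Ψ.ψ := Ψ.contDiff.continuous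
  rw [plainUp_zero, plainDown_eq]
  set cN : ℝ := (Real.sqrt ((m : ℝ) + 1))⁻¹ with hcN
  have hcN0 : 0 ≤ cN := by positivity
  have hcoe : ((Real.sqrt ((m : ℝ) + 1))⁻¹ : ℂ) = ((cN : ℝ) : ℂ) := by
    rw [hcN, Complex.ofReal_inv]
  simp only [hcoe]
  -- `h = n̂₀Ψ = B_0†Ψ`, continuous, with `Q_∅ h = 0`
  have hh : Continuous fun X => ∑ i : Fin (m + 1), fourierAvg m L 0 i Ψ.ψ X := continuous_sum_fourierAvg 0 hψ
  have h0 : modeProj (m + 1) L ∅ (fun X => ∑ i : Fin (m + 1), fourierAvg m L 0 i Ψ.ψ X) = 0 := by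
    rw [modeProj_finset_sum _ (fun i _ => continuous_fourierAvg 0 i hψ)]
    funext X
    rw [Pi.zero_apply]
    exact Finset.sum_eq_zero fun i _ => by
      rw [modeProj_fourierAvg_eq_zero hL 0 (Finset.notMem_empty i) hψ, Pi.zero_apply]
  -- the common overlap `r = ⟨h, n̂₀^{-1/2}h⟩ ≥ N^{-1/2}‖h‖²`
  set r : ℝ := ∑ S ∈ (Finset.univ : Finset (Finset (Fin (m + 1)))).filter (fun S => S.Nonempty),
    (Real.sqrt (S.card : ℝ))⁻¹ * ∫ X in cellN (m + 1) L,
      ‖modeProj (m + 1) L S (fun X => ∑ i : Fin (m + 1), fourierAvg m L 0 i Ψ.ψ X) X‖ ^ 2 with hr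
  have hrle : cN * ∫ X in cellN (m + 1) L, ‖∑ i : Fin (m + 1), fourierAvg m L 0 i Ψ.ψ X‖ ^ 2 ≤ r :=
    Cardinality.rootInv_lower hL hh h0
  have e_up : ∫ X in cellN (m + 1) L, conj (∑ i : Fin (m + 1), fourierAvg m L 0 i Ψ.ψ X) *
      lnssLower m L 0 Ψ.ψ X = (r : ℂ) := Cardinality.integral_conj_mul_rootInv_self hL hh
  have e_low : ∫ X in cellN (m + 1) L, conj (lnssLower m L 0 Ψ.ψ X) *
      (∑ i : Fin (m + 1), fourierAvg m L 0 i Ψ.ψ X) = (r : ℂ) := by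
    rw [← e_up]
    exact (integral_conj_mul_rootInv hh hh).symm
  -- the direction `ζ = cN • h` and (L2)
  have hdD := dir_const_mul (PlainPair.isDirection_dnB 0 (isDirection_trialState Ψ)) (cN : ℂ)
  have hσU : ((m + 1 : ℕ) : ℂ) * srcPair m L 0 (fun X => (cN : ℂ) *
      ∑ i : Fin (m + 1), fourierAvg m L 0 i Ψ.ψ X) Ψ.ψ = ((cN * r : ℝ) : ℂ) := by
    rw [natMul_srcPair_eq_inner_lnssUpper hL 0 hdD.contDiff.continuous hdD.symm hψ Ψ.symm, lnssUpper_zero hL hψ]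
    simp only [map_mul, Complex.conj_ofReal]
    calc ∫ X in cellN (m + 1) L, (cN : ℂ) *
          conj (∑ i : Fin (m + 1), fourierAvg m L 0 i Ψ.ψ X) * lnssLower m L 0 Ψ.ψ X
        = (cN : ℂ) * ∫ X in cellN (m + 1) L,
            conj (∑ i : Fin (m + 1), fourierAvg m L 0 i Ψ.ψ X) * lnssLower m L 0 Ψ.ψ X := by
          rw [← integral_const_mul]
          exact integral_congr_ae (Eventually.of_forall fun X => by ring)
      _ = ((cN * r : ℝ) : ℂ) := by rw [e_up]; push_cast; ring
  have hσD : ((m + 1 : ℕ) : ℂ) * srcPair m L 0 Ψ.ψ (fun X => (cN : ℂ) *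
      ∑ i : Fin (m + 1), fourierAvg m L 0 i Ψ.ψ X) = ((cN * r : ℝ) : ℂ) := by
    rw [natMul_srcPair_eq_inner_lnssLower hL 0 hψ Ψ.symm hdD.contDiff.continuous hdD.symm]
    calc ∫ X in cellN (m + 1) L, conj (lnssLower m L 0 Ψ.ψ X) *
          ((cN : ℂ) * ∑ i : Fin (m + 1), fourierAvg m L 0 i Ψ.ψ X)
        = (cN : ℂ) * ∫ X in cellN (m + 1) L, conj (lnssLower m L 0 Ψ.ψ X) *
            ∑ i : Fin (m + 1), fourierAvg m L 0 i Ψ.ψ X := by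
          rw [← integral_const_mul]
          exact integral_congr_ae (Eventually.of_forall fun X => by ring)
      _ = ((cN * r : ℝ) : ℂ) := by rw [e_low]; push_cast; ring
  -- the mass in real numbers
  set D : ℝ := ∫ X in cellN (m + 1) L, ‖∑ i : Fin (m + 1), fourierAvg m L 0 i Ψ.ψ X‖ ^ 2 with hD
  have hD0 : 0 ≤ D := integral_nonneg fun X => sq_nonneg _
  have hmD : mass L (fun X => (cN : ℂ) * ∑ i : Fin (m + 1), fourierAvg m L 0 i Ψ.ψ X) =
      ENNReal.ofReal (cN ^ 2 * D) := by
    rw [mass_smul, Positivity.coef_sq hcN0]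
    unfold mass
    rw [lintegral_nnnorm_sq_eq _ hh, ← ENNReal.ofReal_mul (sq_nonneg _)]
  -- `2cN²D ≤ 2cN r ≤ 2·(2cN r) = 2·N|σ₊ + σ₋|`
  have hreal : cN ^ 2 * D + cN ^ 2 * D ≤ 2 * (cN * r + cN * r) := by
    have h1 : cN * (cN * D) ≤ cN * r := mul_le_mul_of_nonneg_left hrle hcN0
    nlinarith [mul_nonneg (sq_nonneg cN) hD0]
  have hpos : 0 ≤ cN * r + cN * r := by nlinarith [hreal, mul_nonneg (sq_nonneg cN) hD0]
  have hnorm : ((m + 1 : ℕ) : ℝ) *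
      ‖srcPair m L 0 (fun X => (cN : ℂ) * ∑ i : Fin (m + 1), fourierAvg m L 0 i Ψ.ψ X) Ψ.ψ +
        srcPair m L 0 Ψ.ψ (fun X => (cN : ℂ) * ∑ i : Fin (m + 1), fourierAvg m L 0 i Ψ.ψ X)‖ =
      cN * r + cN * r := by
    have h := congrArg norm (show ((m + 1 : ℕ) : ℂ) * (srcPair m L 0 (fun X => (cN : ℂ) *
        ∑ i : Fin (m + 1), fourierAvg m L 0 i Ψ.ψ X) Ψ.ψ +
          srcPair m L 0 Ψ.ψ (fun X => (cN : ℂ) * ∑ i : Fin (m + 1), fourierAvg m L 0 i Ψ.ψ X)) =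
        ((cN * r + cN * r : ℝ) : ℂ) by rw [mul_add, hσU, hσD]; push_cast; ring)
    rwa [norm_mul, Complex.norm_natCast, Complex.norm_real, Real.norm_of_nonneg hpos] at h
  rw [hmD, ← ENNReal.ofReal_add (by positivity) (by positivity), hnorm, ← ENNReal.ofReal_ofNat,
    ← ENNReal.ofReal_mul (by norm_num)]
  exact ENNReal.ofReal_le_ofReal hreal

/-- **(A3) for every mode `n`.** [folklore] -/
theorem mass_add_mass_le (hL : 0 < L) (n : Fin 3 → ℤ) (Ψ : PeriodicTrialState (m + 1) L) :
    mass L (plainUp m L n Ψ.ψ) + mass L (plainDown m L n Ψ.ψ) ≤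
      2 * ENNReal.ofReal (((m + 1 : ℕ) : ℝ) *
        ‖srcPair m L n (plainUp m L n Ψ.ψ) Ψ.ψ + srcPair m L n Ψ.ψ (plainDown m L n Ψ.ψ)‖) := by
  rcases eq_or_ne n 0 with rfl | hn
  · exact mass_add_mass_le_zero hL Ψ
  · exact mass_add_mass_le_of_ne_zero hL hn Ψ

/-- **(A4)**: `weightedOcc n ψ ≤ 2‖ζ₋‖²` (indeed `weightedOcc = ‖ζ₋‖²` by definition). [folklore] -/
theorem weightedOcc_le (m : ℕ) (L : ℝ) (n : Fin 3 → ℤ) (ψ : Config (m + 1) → ℂ) :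
    weightedOcc m L n ψ ≤ 2 * mass L (plainDown m L n ψ) :=
  le_add_self.trans_eq (two_mul _).symm

end PlainZeroDefect

/-- **Part 3 of `stub_plainPairAlgebra` (registered helper statement)**: (A3) the ZERO-DEFECT RESPONSE of the plain pair
against the LNSS source, `‖ζ₊‖² + ‖ζ₋‖² ≤ 2N|σ_n(ζ₊,Ψ) + σ_n(Ψ,ζ₋)|` for EVERY mode `n` and every periodic trial state
(`ζ₊ = plainUp n Ψ`, `ζ₋ = plainDown n Ψ`), and (A4) `weightedOcc n Ψ ≤ 2‖ζ₋‖²`. [folklore]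
(arXiv:1211.2778 §2; LSSY2005 App. A) -/
theorem plainPair_zeroDefect :
    ∀ (m : ℕ) (L : ℝ), 0 < L → ∀ (n : Fin 3 → ℤ)
      (Ψ : Literature.MathematicalPhysics.QuantumManyBody.BoseGas.PeriodicTrialState (m + 1) L),
      Summit.AtomisticToContinuum.BoseEinsteinCondensation.Cruxes.GDTransfer.DysonDressedWitness.mass L
            (plainUp m L n Ψ.ψ) +
          Summit.AtomisticToContinuum.BoseEinsteinCondensation.Cruxes.GDTransfer.DysonDressedWitness.mass L
            (plainDown m L n Ψ.ψ) ≤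
        2 * ENNReal.ofReal (((m + 1 : ℕ) : ℝ) *
          ‖Summit.AtomisticToContinuum.BoseEinsteinCondensation.Cruxes.GDTransfer.DysonDressedWitness.srcPair m L n
                (plainUp m L n Ψ.ψ) Ψ.ψ +
              Summit.AtomisticToContinuum.BoseEinsteinCondensation.Cruxes.GDTransfer.DysonDressedWitness.srcPair m L n
                Ψ.ψ (plainDown m L n Ψ.ψ)‖) ∧
      weightedOcc m L n Ψ.ψ ≤
        2 * Summit.AtomisticToContinuum.BoseEinsteinCondensation.Cruxes.GDTransfer.DysonDressedWitness.mass L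
          (plainDown m L n Ψ.ψ) :=
  fun m L hL n Ψ => ⟨PlainZeroDefect.mass_add_mass_le hL n Ψ, PlainZeroDefect.weightedOcc_le m L n Ψ.ψ⟩

end Summit.AtomisticToContinuum.BoseEinsteinCondensation.Cruxes.GDTransfer.Seeded

end
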